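import Summits.HubbardSuperconductivity.Statement
import Literature.MathematicalPhysics.QuantumLattice.DWaveSource

/-!
# Route `ThermalWedge`, item `stmt-HubbardSuperconductivity-13891`: the assembly (rev 2), structural

The rev-2 assembly of route `ThermalWedge` is `TwSeededRung ∧ TwTipContinuation → HubbardSuperconductivity`
(the rev-1 item `stmt-HubbardSuperconductivity-1707`, `TwSeededRung → TwTipContinuation → …`, uncurried).
It is pure logic.  `TwTipContinuation` delivers a coupling ceiling `U₁` and a doping `δ ∈ [1/10, 2/5]`
at which seeded `d`-wave order down to seeds `g = K·U` (for every `K > 0` with `K·U ≤ 1/20`) forces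
the summit's conclusion for `hubbardTorus 2 L 1 U`; `TwSeededRung` delivers, at that `δ`, a ceiling
`U₀` and a `K > 0` with `K·U₀ ≤ 1/20` and exactly that seeded order for every `0 < U ≤ U₀`.  With
`U := min U₀ U₁` both apply, `K·U ≤ K·U₀ ≤ 1/20`, and `[1/10, 2/5] ⊂ (0, 1/2)` supplies the summit's
doping window (same term as the route's deciding theorem `ThermalWedge.closes`).

DESIGN (requested by the route repair, item text of `stmt-HubbardSuperconductivity-13891`): the TYPE
is spelled out STRUCTURALLY — the verbatim bodies of the route decls `TwSeededRung` and
`TwTipContinuation` (Theses/ThermalWedge.lean rev 2) and the summit constant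
`_root_.HubbardSuperconductivity` — and this module imports only
`Summits.HubbardSuperconductivity.Statement` and `Literature.MathematicalPhysics.QuantumLattice.DWaveSource`,
NOT the Theses module: the gate appends `Assembly_holds := _root_.<this theorem>` to the Theses file
by importing this module there, so a Theses import here would close an import cycle (the failure
that detached the rev-1 file `Theorems/ThermalWedgeAssembly.lean`).  The type is definitionally
equal to `Summit.HubbardSuperconductivity.HubbardSuperconductivity.Theses.ThermalWedge.Assembly`
(`δ`-unfolding of the three defs; checked against the rev-2 Theses file with
`example : ThermalWedge.Assembly := thermalWedge_assembly_structural` in a scratch file, rc 0).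
-/

namespace Summit.HubbardSuperconductivity.HubbardSuperconductivity.Theorems

open scoped Matrix ComplexOrder

/-- **Assembly of route `ThermalWedge` (rev 2, item `stmt-HubbardSuperconductivity-13891`), stated
structurally**: (seeded rung `TwSeededRung`) ∧ (tip continuation `TwTipContinuation`) →
`HubbardSuperconductivity`.  Pure logic: `U := min U₀ U₁`, `δ` from the tip,
`K·U ≤ K·U₀ ≤ 1/20`, `[1/10,2/5] ⊂ (0,1/2)`. [folklore] -/
theorem thermalWedge_assembly_structural :
    ((∀ δ ∈ Set.Icc (1/10 : ℝ) (2/5 : ℝ), ∃ U₀ K : ℝ, 0 < U₀ ∧ 0 < K ∧ K * U₀ ≤ 1 / 20 ∧ ∀ U ∈ Set.Ioc (0 : ℝ) U₀, (∀ g ∈ Set.Icc (K * U) (1 / 10), ∃ c : ℝ, 0 < c ∧ ∃ L₀ : ℕ, ∀ (L : ℕ) [NeZero L], L₀ ≤ L → Even L → ∀ (ψ : Literature.MathematicalPhysics.QuantumLattice.Fock (Literature.MathematicalPhysics.QuantumLattice.Orb (Literature.MathematicalPhysics.QuantumLattice.FermionTorus 2 L))), star ψ ⬝ᵥ ψ =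 1 → Literature.MathematicalPhysics.QuantumLattice.IsGroundStateInSector (Literature.MathematicalPhysics.QuantumLattice.hubbardTorus 2 L 1 U - ((g / (L : ℝ) ^ 2 : ℝ) : ℂ) • ((Literature.MathematicalPhysics.QuantumLattice.pairField Literature.MathematicalPhysics.QuantumLattice.dWaveFormFactor L)ᴴ * Literature.MathematicalPhysics.QuantumLattice.pairField Literature.MathematicalPhysics.QuantumLattice.dWaveFormFactor L)) (2 * ⌊(1 - δ) * (L : ℝ) ^ 2 / 2⌋₊) 0 ψ → c * (L : ℝ) ^ 4 ≤ (Literature.MathematicalPhysics.QuantumLattice.expect ((Literature.MathematicalPhysics.QuantumLattice.pairField Literature.MathematicalPhysics.QuantumLattice.dWaveFormFactor L)ᴴ * Literature.MathematicalPhysics.QuantumLattice.pairField Literature.MathematicalPhysics.QuantumLattice.dWaveFormFactor L) ψ).re)) ∧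
      (∃ U₁ : ℝ, 0 < U₁ ∧ ∃ δ ∈ Set.Icc (1/10 : ℝ) (2/5 : ℝ), ∀ U ∈ Set.Ioc (0 : ℝ) U₁, ∀ K : ℝ, 0 < K → K * U ≤ 1 / 20 → (∀ g ∈ Set.Icc (K * U) (1 / 10), ∃ c : ℝ, 0 < c ∧ ∃ L₀ : ℕ, ∀ (L : ℕ) [NeZero L], L₀ ≤ L → Even L → ∀ (ψ : Literature.MathematicalPhysics.QuantumLattice.Fock (Literature.MathematicalPhysics.QuantumLattice.Orb (Literature.MathematicalPhysics.QuantumLattice.FermionTorus 2 L))), star ψ ⬝ᵥ ψ = 1 → Literature.MathematicalPhysics.QuantumLattice.IsGroundStateInSector (Literature.MathematicalPhysics.QuantumLattice.hubbardTorus 2 L 1 U - ((g / (L : ℝ) ^ 2 : ℝ) : ℂ) • ((Literature.MathematicalPhysics.QuantumLattice.pairField Literature.MathematicalPhysics.QuantumLattice.dWaveFormFactor L)ᴴ * Literature.MathematicalPhysics.QuantumLattice.pairField Literature.MathematicalPhysics.QuantumLattice.dWaveFormFactor L)) (2 * ⌊(1 - δ) * (L : ℝ) ^ 2 / 2⌋₊)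 0 ψ → c * (L : ℝ) ^ 4 ≤ (Literature.MathematicalPhysics.QuantumLattice.expect ((Literature.MathematicalPhysics.QuantumLattice.pairField Literature.MathematicalPhysics.QuantumLattice.dWaveFormFactor L)ᴴ * Literature.MathematicalPhysics.QuantumLattice.pairField Literature.MathematicalPhysics.QuantumLattice.dWaveFormFactor L) ψ).re) → (∀ (N : ℕ → ℕ) (ψ : ∀ L, Literature.MathematicalPhysics.QuantumLattice.Fock (Literature.MathematicalPhysics.QuantumLattice.Orb (Literature.MathematicalPhysics.QuantumLattice.FermionTorus 2 L))), (∀ L, Even L → N L = 2 * ⌊(1 - δ) * (L : ℝ) ^ 2 / 2⌋₊ ∧ star (ψ L) ⬝ᵥ ψ L = 1 ∧ Literature.MathematicalPhysics.QuantumLattice.IsGroundStateInSector (Literature.MathematicalPhysics.QuantumLattice.hubbardTorus 2 L 1 U) (N L) 0 (ψ L)) → Literature.Probability.LatticeModels.HasLongRangeOrder (fun k => Literature.Probability.LatticeModels.halfOpenBox 2 (2 * k)) (fun k => Literature.MathematicalPhysics.QuantumLattice.torusPullback (Literature.MathematicalPhysics.QuantumLattice.pairFieldCorr Literature.MathematicalPhysics.QuantumLattice.dWaveFormFactor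 ψ) (2 * k))))) →
      _root_.HubbardSuperconductivity := by
  rintro ⟨hR, hT⟩
  obtain ⟨U₁, hU₁, δ, hδ, hTip⟩ := hT
  obtain ⟨U₀, K, hU₀, hK, hKU₀, hRung⟩ := hR δ hδ
  have hUpos : 0 < min U₀ U₁ := lt_min hU₀ hU₁
  have hU₀mem : min U₀ U₁ ∈ Set.Ioc (0 : ℝ) U₀ := ⟨hUpos, min_le_left _ _⟩
  have hU₁mem : min U₀ U₁ ∈ Set.Ioc (0 : ℝ) U₁ := ⟨hUpos, min_le_right _ _⟩
  have hKU : K * min U₀ U₁ ≤ 1 / 20 :=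
    le_trans (mul_le_mul_of_nonneg_left (min_le_left _ _) hK.le) hKU₀
  have hδ' : δ ∈ Set.Ioo (0 : ℝ) (1 / 2) := by
    obtain ⟨h₁, h₂⟩ := hδ
    constructor <;> linarith
  exact ⟨min U₀ U₁, hUpos, δ, hδ', fun N ψ hyp =>
    hTip (min U₀ U₁) hU₁mem K hK hKU (hRung (min U₀ U₁) hU₀mem) N ψ hyp⟩

end Summit.HubbardSuperconductivity.HubbardSuperconductivity.Theorems
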